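import Literature.IUT.HodgeTheaters.KitS5LocalOfDatum
import HarnessLib

/-!
# The isomorphism kit of the ΘNF side FROM abc-iut-L5-t3's Definition 5.5 morphisms: `S5Local.IsoKit.ofDatum`
# (intra-layer merge C9-h, ΘNF side, part 2; defs + proofs)

S. Mochizuki, *Inter-universal Teichmüller theory I*, kurims manuscript (May 2020): Definition 4.6 (i) p. 111 (morphisms of
`𝒟`-NF-bridges: "a capsule-full poly-isomorphism `†𝔇_J ⥲ ‡𝔇_{J'}`" and "an `Aut_ε(†𝒟^⊚)`-orbit of isomorphisms
`†𝒟^⊚ ⥲ ‡𝒟^⊚`", compatible with `†φ^NF_⋆`, `‡φ^NF_⋆`), (ii) p. 111 (morphisms of `𝒟-Θ`-bridges), (iii) p. 112 ("a pair of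
morphisms between the respective associated `𝒟`-NF- and `𝒟-Θ`-bridges that are compatible with one another in the sense
that they induce the same bijection between the index sets"), Definition 5.5 (iii) p. 153 (isomorphisms of ΘNF-Hodge
theaters; "the associated data `{‡φ^NF_⋆, ‡φ^Θ_⋆}` forms a `𝒟`-ΘNF-Hodge theater"), Corollary 5.6 (ii) p. 153 ("the
natural functorially induced map from the set of isomorphisms between two ΘNF-Hodge theaters to the set of isomorphisms
between the respective associated `𝒟`-ΘNF-Hodge theaters")
([IUTchI] Def 5.5 (iii) p.153) [claim: Mochizuki2012, status: disputed] (D-0012 claim key, series status DISPUTED — a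
DICTIONARY between two landed typings of the cell plus a construction; nothing of the series is asserted, no side
is taken on [IUTchIII] Cor. 3.12).

## What this file does (abc-iut-L5-t5's `ThetaPMEllNFHodgeTheatersIso.lean`, `S5Local.IsoKit`: every field
"TODO-merge:abc-iut-L5-t3")

Over the instantiated ΘNF-side kit `S5Local.ofDatum S fc nl` (`KitS5LocalOfDatum.lean`: ΘNF-Hodge theaters := abc-iut-L5-t3's
REAL `ThetaNFHodgeTheater S`), this file instantiates abc-iut-L5-t5's isomorphism kit `IsoKit`:

* `OfDatum.DIso X₁ X₂` — isomorphisms of `𝒟`-ΘNF-Hodge theaters in kit form, FIELD-FOR-FIELD the shape of abc-iut-L5-t3's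
  `DThetaNFHodgeTheater.Hom` (Def 4.6 (iii)): a kit-level `𝒟-Θ`-bridge morphism (abc-iut-w5-d228's
  `DThetaBridgeData.Hom`: bijection of index sets + compatibility), an `Aut_ε(†𝒟^⊚)`-orbit of isomorphisms of the global
  objects (abc-iut-L5-t3's `autLabel`, the global objects of `ofDatum` BEING `𝔡.AmbG`) and the NF-compatibility, with the
  SAME bijection of index sets;
* **`IsoKit.ofDatum`**: `thGlob H := base(‡ℱ^⊚)`, `thNFPoly H :=` the intrinsic `𝒟`-NF-bridge poly-morphisms of `‡ψ^NF_⋆` read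
  in the kit, `th_isHT :=` the THEOREM `isDThetaNFHT_under`, **`thIso := ThetaNFHodgeTheater.Hom`** (abc-iut-L5-t3's Def 5.5
  (iii) morphisms), `thIsoIndex φ := φ.theta.under.ι`, `dIso := DIso`, `dIsoIndex ψ := ψ.theta.ι`, and **`thIsoToD`** = Cor
  5.6 (ii)'s "natural functorially induced map", CONSTRUCTED: the underlying `DThetaNFHodgeTheater.Hom` of `φ`
  (`ThetaNFHodgeTheater.Hom.under`) read in the kit — its compatibilities PROVED by transporting abc-iut-L5-t3's through
  the fully faithful comparison functors (`transport_postSat`, `transport_preSat`, `transport_post`, `transport_pre`);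
  `thIsoToD_index` holds by `rfl`.

So the §6 isomorphism notions (`ThetaPMEllNFHT.Iso NI`, `DThetaPMEllNFHT.Iso NI`, full poly-isomorphisms) specialise,
at `NI := IsoKit.ofDatum fc nl`, to abc-iut-L5-t3's Definition 5.5 morphisms.  typed ≠ proved elsewhere; here every
`theorem` is kernel-checked.
-/

namespace Literature.IUT.HodgeTheaters

open CategoryTheory

universe u

namespace BaseThetaDatum

/-! ### Transport of iso-saturated poly-morphisms through a fully faithful functor (plumbing) -/

section Transport

variable {C D : Type*} [Category C] [Category D] {G : C ⥤ D}

/-- Post-saturation by isomorphisms commutes with transport through a fully faithful functor and conjugating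
isomorphisms: `{(a⁻¹ G(f) b) ≫ γ̂} = {a⁻¹ G(f ≫ γ) b'}`. [folklore] -/
private theorem transport_postSat (hG : G.FullyFaithful) {P R R' : C} {Ph Rh Rh' : D} (a : G.obj P ≅ Ph) (b : G.obj R ≅ Rh)
    (b' : G.obj R' ≅ Rh') (poly : Set (P ⟶ R)) :
    {h : Ph ⟶ Rh' | ∃ g ∈ {g : Ph ⟶ Rh | ∃ f ∈ poly, g = a.inv ≫ G.map f ≫ b.hom}, ∃ γ : Rh ≅ Rh', h = g ≫ γ.hom} =
      {h | ∃ s ∈ {s : P ⟶ R' | ∃ f ∈ poly, ∃ γ : R ≅ R', s = f ≫ γ.hom}, h = a.inv ≫ G.map s ≫ b'.hom} := by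
  ext h
  constructor
  · rintro ⟨g, ⟨f, hf, rfl⟩, γ, rfl⟩
    refine ⟨f ≫ (hG.preimageIso (b ≪≫ γ ≪≫ b'.symm)).hom, ⟨f, hf, _, rfl⟩, ?_⟩
    simp [Functor.FullyFaithful.preimageIso]
  · rintro ⟨s, ⟨f, hf, γ, rfl⟩, rfl⟩
    exact ⟨a.inv ≫ G.map f ≫ b.hom, ⟨f, hf, rfl⟩, b.symm ≪≫ G.mapIso γ ≪≫ b', by simp⟩

/-- Pre-saturation by isomorphisms commutes with transport likewise: `{κ̂ ≫ (a'⁻¹ G(f') b')} = {a⁻¹ G(κ ≫ f') b'}`. [folklore] -/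
private theorem transport_preSat (hG : G.FullyFaithful) {P Q R' : C} {Ph Qh Rh' : D} (a : G.obj P ≅ Ph) (a' : G.obj Q ≅ Qh)
    (b' : G.obj R' ≅ Rh') (poly' : Set (Q ⟶ R')) :
    {h : Ph ⟶ Rh' | ∃ κ : Ph ≅ Qh, ∃ g ∈ {g : Qh ⟶ Rh' | ∃ f ∈ poly', g = a'.inv ≫ G.map f ≫ b'.hom}, h = κ.hom ≫ g} =
      {h | ∃ s ∈ {s : P ⟶ R' | ∃ κ : P ≅ Q, ∃ f ∈ poly', s = κ.hom ≫ f}, h = a.inv ≫ G.map s ≫ b'.hom} := by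
  ext h
  constructor
  · rintro ⟨κ, g, ⟨f, hf, rfl⟩, rfl⟩
    refine ⟨(hG.preimageIso (a ≪≫ κ ≪≫ a'.symm)).hom ≫ f, ⟨_, f, hf, rfl⟩, ?_⟩
    simp [Functor.FullyFaithful.preimageIso]
  · rintro ⟨s, ⟨κ, f, hf, rfl⟩, rfl⟩
    exact ⟨a.symm ≪≫ G.mapIso κ ≪≫ a', a'.inv ≫ G.map f ≫ b'.hom, ⟨f, hf, rfl⟩, by simp⟩

end Transport

namespace S5Local

variable {𝔡 : BaseThetaDatum.{u+1}} {K : PMBaseKit.{u+1} 𝔡.l} {S : S5Local 𝔡} {c : 𝔡.KitCore K} {M : K.MultKit}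
  {FK : K.FKit M} (fc : S.FKitCore c FK) (nl : c.NFLink)

/-! ### Transport of `φ^NF`-type poly-morphisms through `NFLink` (plumbing) -/

/-- Post-composition with a set of isomorphisms of `†𝒟^⊚` commutes with reading `φ^NF`-type morphisms in the kit
(`homNF_postNF`). ([IUTchI] Def 4.1 (v) p.97) [claim: Mochizuki2012, status: disputed] -/
theorem transport_post (x : K.V) {X : 𝔡.Amb (c.e x)} {Y Y' : 𝔡.AmbG} {Xh : K.Amb x} (a : (c.amb x).obj X ≅ Xh)
    (P : PolyHomNF (c.e x) X Y) (B : Set (Y ≅ Y')) :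
    {h : Xh ⟶ (nl.nfAtV x).obj Y' | ∃ g ∈ {g : Xh ⟶ (nl.nfAtV x).obj Y | ∃ f ∈ P, g = a.inv ≫ nl.homNF x X Y f},
        ∃ b ∈ B, h = g ≫ (nl.nfAtV x).map b.hom} =
      {h | ∃ s ∈ P.post B, h = a.inv ≫ nl.homNF x X Y' s} := by
  ext h
  constructor
  · rintro ⟨g, ⟨f, hf, rfl⟩, b, hb, rfl⟩
    exact ⟨𝔡.postNF f b, ⟨f, hf, b, hb, rfl⟩, by rw [nl.homNF_postNF, Category.assoc]⟩
  · rintro ⟨s, ⟨f, hf, b, hb, rfl⟩, rfl⟩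
    exact ⟨a.inv ≫ nl.homNF x X Y f, ⟨f, hf, rfl⟩, b, hb, by rw [nl.homNF_postNF, Category.assoc]⟩

/-- Pre-composition with isomorphisms of the constituents commutes with reading `φ^NF`-type morphisms in the kit
(`homNF_preNF`, fullness of the comparison functor). ([IUTchI] Def 4.1 (v) p.97) [claim: Mochizuki2012, status: disputed] -/
theorem transport_pre (x : K.V) {X X' : 𝔡.Amb (c.e x)} {Y : 𝔡.AmbG} {Xh Xh' : K.Amb x} (a : (c.amb x).obj X ≅ Xh)
    (a' : (c.amb x).obj X' ≅ Xh') (P' : PolyHomNF (c.e x) X' Y) :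
    {h : Xh ⟶ (nl.nfAtV x).obj Y | ∃ κ : Xh ≅ Xh',
        ∃ g ∈ {g : Xh' ⟶ (nl.nfAtV x).obj Y | ∃ f ∈ P', g = a'.inv ≫ nl.homNF x X' Y f}, h = κ.hom ≫ g} =
      {h | ∃ s ∈ {s : 𝔡.HomNF (c.e x) X Y | ∃ κ : X ≅ X', ∃ f ∈ P', s = 𝔡.preNF κ f},
        h = a.inv ≫ nl.homNF x X Y s} := by
  ext h
  constructor
  · rintro ⟨κ, g, ⟨f, hf, rfl⟩, rfl⟩
    refine ⟨𝔡.preNF ((c.ambFF x).preimageIso (a ≪≫ κ ≪≫ a'.symm)) f, ⟨_, f, hf, rfl⟩, ?_⟩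
    rw [nl.homNF_preNF]
    simp [Functor.FullyFaithful.preimageIso]
  · rintro ⟨s, ⟨κ, f, hf, rfl⟩, rfl⟩
    refine ⟨a.symm ≪≫ (c.amb x).mapIso κ ≪≫ a', a'.inv ≫ nl.homNF x X' Y f, ⟨f, hf, rfl⟩, ?_⟩
    rw [nl.homNF_preNF]
    simp

/-! ### Isomorphisms of `𝒟`-ΘNF-Hodge theaters in kit form (Def 4.6 (iii) shape) -/

/-- **[IUTchI] Def 4.6 (iii), morphisms, for the instantiated kit** ("a pair of morphisms between the respective
associated `𝒟`-NF- and `𝒟-Θ`-bridges that are compatible with one another in the sense that they induce the same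
bijection between the index sets") — FIELD-FOR-FIELD abc-iut-L5-t3's `DThetaNFHodgeTheater.Hom`/`DNFBridge.Hom` shape on
abc-iut-L5-t5's kit-form `𝒟`-ΘNF-Hodge theaters `DNFHT` of `ofDatum`: the `𝒟-Θ`-bridge morphism (abc-iut-w5-d228's
`DThetaBridgeData.Hom`, Def 4.6 (ii)), the `Aut_ε(†𝒟^⊚)`-orbit of isomorphisms `†𝒟^⊚ ⥲ ‡𝒟^⊚` (Def 4.6 (i); the global
objects ARE `𝔡.AmbG`, `autLabel` abc-iut-L5-t3's) and the NF-compatibility with the SAME index bijection.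
([IUTchI] Def 4.6 (iii) p.112) [claim: Mochizuki2012, status: disputed] -/
structure OfDatum.DIso (X₁ X₂ : (ofDatum fc nl).DNFHT) where
  /-- the morphism of underlying `𝒟-Θ`-bridges (index bijection `ι` + compatibility, Def 4.6 (ii)) -/
  theta : PMBaseKit.DThetaBridgeData.Hom X₁.thBridge X₂.thBridge
  /-- the `Aut_ε`-orbit of isomorphisms `†𝒟^⊚ ⥲ ‡𝒟^⊚` (Def 4.6 (i)) -/
  orbit : Set (X₁.glob ≅ X₂.glob)
  /-- it is one `Aut_ε(†𝒟^⊚)`-orbit -/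
  isOrbit : ∃ δ : X₁.glob ≅ X₂.glob, orbit = {δ' | ∃ β : X₁.glob ≅ X₁.glob, autLabel β = 1 ∧ δ' = β ≪≫ δ}
  /-- compatibility with the `𝒟`-NF-bridges (Def 4.6 (i)), along the SAME index bijection `theta.ι` (Def 4.6 (iii)) -/
  commNF : ∀ j x,
    {h | ∃ g ∈ X₁.nfPoly j x, ∃ b ∈ orbit, h = g ≫ ((ofDatum fc nl).nfAtV x).map b.hom} =
      {h | ∃ (κ : (X₁.thBridge.capsule j).obj x ≅ (X₂.thBridge.capsule (theta.ι j)).obj x),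
        ∃ g ∈ X₂.nfPoly (theta.ι j) x, h = κ.hom ≫ g}

/-! ### Cor 5.6 (ii): the natural map, constructed -/

/-- **[IUTchI] Cor 5.6 (ii), "the natural functorially induced map from the set of isomorphisms between two ΘNF-Hodge
theaters to the set of isomorphisms between the respective associated `𝒟`-ΘNF-Hodge theaters"**, for the instantiated
kit — CONSTRUCTED: the underlying `DThetaNFHodgeTheater.Hom` of a Def 5.5 (iii) morphism (abc-iut-L5-t3's `Hom.under`)
read in the kit through the dictionaries (index bijection kept; the `𝒟-Θ`-compatibility transported through the fully
faithful comparison functors; the `Aut_ε`-orbit kept verbatim; the NF-compatibility transported through `NFLink`).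
([IUTchI] Cor 5.6 (ii) p.153) [claim: Mochizuki2012, status: disputed] -/
noncomputable def OfDatum.homToDIso {H₁ H₂ : S.ThetaNFHodgeTheater} (φ : ThetaNFHodgeTheater.Hom H₁ H₂) :
    OfDatum.DIso fc nl (dnfhtOf fc nl H₁) (dnfhtOf fc nl H₂) where
  theta :=
    { ι := Equiv.ulift.trans (φ.theta.under.ι.trans Equiv.ulift.symm)
      comm := fun j x =>
        (transport_postSat (c.ambFF x) ((fc.baseComm x).app (H₁.capsuleF j.down (c.e x)))
            ((fc.baseComm x).app (S.assocStrip H₁.HT (c.e x))) ((fc.baseComm x).app (S.assocStrip H₂.HT (c.e x)))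
            (H₁.underPolyΘ j.down (c.e x))).trans
          ((congrArg (fun T => {h | ∃ s ∈ T, h = ((fc.baseComm x).app (H₁.capsuleF j.down (c.e x))).inv ≫
              (c.amb x).map s ≫ ((fc.baseComm x).app (S.assocStrip H₂.HT (c.e x))).hom})
            (φ.theta.under.comm j.down (c.e x))).trans
          (transport_preSat (c.ambFF x) ((fc.baseComm x).app (H₁.capsuleF j.down (c.e x)))
            ((fc.baseComm x).app (H₂.capsuleF (φ.theta.under.ι j.down) (c.e x)))
            ((fc.baseComm x).app (S.assocStrip H₂.HT (c.e x))) (H₂.underPolyΘ (φ.theta.under.ι j.down) (c.e x))).symm) }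
  orbit := φ.nf.under.orbit
  isOrbit := φ.nf.under.isOrbit
  commNF j x :=
    (transport_post nl x ((fc.baseComm x).app (H₁.capsuleF j.down (c.e x))) ((H₁.psiNF j.down).under (c.e x))
        φ.nf.under.orbit).trans
      ((congrArg (fun T => {h | ∃ s ∈ T, h = ((fc.baseComm x).app (H₁.capsuleF j.down (c.e x))).inv ≫ nl.homNF x _ _ s})
        (show ((H₁.psiNF j.down).under (c.e x)).post φ.nf.under.orbit =
            {s | ∃ κ : (H₁.capsuleF j.down).base (c.e x) ≅ (H₂.capsuleF (φ.theta.under.ι j.down)).base (c.e x),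
              ∃ f ∈ (H₂.psiNF (φ.theta.under.ι j.down)).under (c.e x), s = 𝔡.preNF κ f} by
          have h := φ.nf.under.comm j.down (c.e x)
          rw [φ.compat] at h
          exact h)).trans
      (transport_pre nl x ((fc.baseComm x).app (H₁.capsuleF j.down (c.e x)))
        ((fc.baseComm x).app (H₂.capsuleF (φ.theta.under.ι j.down) (c.e x)))
        ((H₂.psiNF (φ.theta.under.ι j.down)).under (c.e x))).symm)

/-! ### The isomorphism kit, instantiated -/

/-- **`S5Local.IsoKit.ofDatum` — abc-iut-L5-t5's isomorphism kit on the ΘNF side READ OFF abc-iut-L5-t3's Definition 5.5**: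
global object `‡𝒟^⊚ := base(‡ℱ^⊚)`; `𝒟`-NF-bridge poly-morphisms := the intrinsic `under` of `‡ψ^NF_⋆` read in the kit; "the
associated data form a `𝒟`-ΘNF-Hodge theater" := the THEOREM `isDThetaNFHT_under`; **isomorphisms of ΘNF-Hodge theaters :=
abc-iut-L5-t3's `ThetaNFHodgeTheater.Hom`** (Def 5.5 (iii)) with index bijection `φ.theta.under.ι`; isomorphisms of
`𝒟`-ΘNF-Hodge theaters := `OfDatum.DIso` (Def 4.6 (iii) shape) with index bijection `ψ.theta.ι`; Cor 5.6 (ii)'s natural map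
:= `OfDatum.homToDIso`, inducing the same index bijection (`rfl`).
([IUTchI] Def 5.5 (iii) p.153) [claim: Mochizuki2012, status: disputed] -/
noncomputable def IsoKit.ofDatum : (ofDatum fc nl).IsoKit where
  thGlob H := S.baseG H.globF
  thNFPoly H j x := {g | ∃ f ∈ (H.psiNF j.down).under (c.e x),
    g = ((fc.baseComm x).app (H.capsuleF j.down (c.e x))).inv ≫ nl.homNF x _ _ f}
  th_isHT H := isDThetaNFHT_under fc nl H
  thIso H₁ H₂ := ThetaNFHodgeTheater.Hom H₁ H₂
  thIsoIndex φ := φ.theta.under.ι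
  dIso := OfDatum.DIso fc nl
  dIsoIndex ψ := ψ.theta.ι
  thIsoToD φ := OfDatum.homToDIso fc nl φ
  thIsoToD_index _ _ := rfl

/-- For the instantiated isomorphism kit, the associated `𝒟`-ΘNF-Hodge theater of abc-iut-L5-t5 (`IsoKit.assocD`) is
`dnfhtOf` (the associated data of the Def 5.5 (iii) Hodge theater). ([IUTchI] Def 5.5 (iii) p.153) [claim: Mochizuki2012, status: disputed] -/
theorem IsoKit.ofDatum_assocD (H : S.ThetaNFHodgeTheater) :
    (IsoKit.ofDatum fc nl).assocD H = dnfhtOf fc nl H := rfl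

/-- The index bijection that abc-iut-L5-t5's kit attaches to a Def 5.5 (iii) morphism is the common bijection of its NF-
and Θ-components (abc-iut-L5-t3's `compat`). ([IUTchI] Def 5.5 (iii) p.153) [claim: Mochizuki2012, status: disputed] -/
theorem IsoKit.ofDatum_thIsoIndex_eq_nf {H₁ H₂ : S.ThetaNFHodgeTheater} (φ : ThetaNFHodgeTheater.Hom H₁ H₂) :
    (IsoKit.ofDatum fc nl).thIsoIndex φ = φ.nf.under.ι := φ.compat.symm

end S5Local

end BaseThetaDatum

end Literature.IUT.HodgeTheaters
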